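import Mathlib
import HarnessLib
import Summits.HodgeConjecture.HodgeConjecture.Theses.LinearSystemTorelli
import Summits.HodgeConjecture.HodgeConjecture.Theses.QbarEnvelope
import Summits.HodgeConjecture.HodgeConjecture.Theses.HolomorphicDefect
import Literature.Barriers.HodgeConjecture.DecompositionOfTheDiagonal

/-!
# Crux `MiddleDivisorSupportFourfold` (stmt-HodgeConjecture-2409) — round-2 ideator 4, first lemmas

Two crux ideas, both GLOBAL (every smooth projective fourfold), both organised around the
GEOMETRIC GENUS switch `GenusZero X` (no non-zero class of type (4,0)) :

* `GenusSwitch` (card `genus-switch-bloch-vs-atypical`): the crux follows from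
  `BlochFour` (generalized Bloch, k = 4: h^{4,0} = 0 ⇒ CH₀ supported on a threefold) +
  `BlochSrinivasFour` (Bloch–Srinivas 1983 Thm 1 / Voisin 2025 Rem. 5.9, theorem in print) on the
  genus-zero side, and from `PositiveGenusEnvelope` (Voisin's ℚ̄-envelope for (2,2)-classes of
  fourfolds WITH a holomorphic 4-form — level ≥ 3, where the Hodge locus is atypical, BKU 2024 Thm 2.3)
  + `QbarCodimTwo` (HC in codimension 2 for ℚ̄-definable varieties) + the QbarEnvelope support item
  `PullbackAlgebraic` on the positive-genus side.  The composition `crux_of` is PROVED below.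
* `ThetaASD` (card `theta-asd-off-canonical-divisor`): `positiveGenusReduction` — the crux for
  fourfolds carrying a non-zero holomorphic 4-form implies the crux (cyclic covers branched along
  pluri-ample divisors; push–pull preserves divisor support).  Stated as a Prop (`PositiveGenusReduction`),
  to be proved with finite-cover transfer; the analytic stubs of that card are informal until
  HolomorphicDefect's wanted notions (`SmoothHermitianBundle`, …) land.
* Service lemma: HolomorphicDefect's support item `FourfoldHodgeClassesConiveauOne` (stmt-3031) is
  definitionally THIS crux (`holomorphicDefect_fourfold_iff`).
-/

noncomputable section

open CategoryTheory

namespace Summit.HodgeConjecture.HodgeConjecture.Cruxes.MiddleDivisorSupportFourfold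

open Literature.AlgebraicGeometry.Motives Literature.AlgebraicGeometry.HodgeTheory
open Literature.Barriers.HodgeConjecture

/-- The crux, by name. -/
abbrev Crux : Prop := Theses.LinearSystemTorelli.MiddleDivisorSupportFourfold

/-- `X` has GEOMETRIC GENUS ZERO in the tree's real-carrier sense: no non-zero class of Hodge type
(4,0) in `H⁴(X(ℂ);ℂ)` (for smooth projective `X` with a Hodge model: `h^{4,0}(X) = 0`; equivalently
the transcendental part `T(X)` of the route's thesis vanishes; equivalently the VHS on `H⁴` has
level ≤ 2).  Same shape as the hypothesis of item `ConiveauOneOfVanishingGenus` (stmt-2410). -/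
def GenusZero (X : SchemeOver ℂ) : Prop :=
  ∀ c : complexBetti X 4, IsOfHodgeType 4 X 4 4 0 c → c = 0

/-- `W` is definable over a number field (verbatim the clause used by route QbarEnvelope). -/
def DefinedOverNumberField (W : SchemeOver ℂ) : Prop :=
  ∃ (K : Type) (_ : Field K) (_ : NumberField K) (σ : K →+* ℂ) (W₀ : SchemeOver K),
    Nonempty (W ≅ (baseChangeHom σ).obj W₀)

namespace GenusSwitch

/-- STUB (crux, genus-zero side; generalized Bloch conjecture at `k = 4`, the converse of the
Mumford–Roitman theorem Voisin II Thm 10.17): a smooth projective fourfold without holomorphic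
4-form has `CH₀` supported on a closed subset of dimension ≤ 3. -/
def BlochFour : Prop :=
  ∀ ⦃X : SchemeOver ℂ⦄, IsSmoothProjective 4 X → GenusZero X → HasChowZeroSupportedInDimLE X 3

/-- STUB (support, theorem in print: Bloch–Srinivas 1983 Thm 1, Voisin JOMP 2025 Rem. 5.9,
Conte–Murre): `CH₀` supported on a threefold ⇒ every rational (2,2)-class of the fourfold is
supported on a divisor (indeed algebraic: decomposition of the diagonal `mΔ = Z₁ + Z₂`,
`Z₂ ⊂ T × X`, `Z₁ ⊂ X × W`, hard Lefschetz + Lefschetz (1,1) on a resolution of `W`). The tree has the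
`dim W ≤ 1` range (`supportedClasses_eq_top_of_hasChowZeroSupportedInDimLE`); `d = 3` is new work. -/
def BlochSrinivasFour : Prop :=
  ∀ ⦃X : SchemeOver ℂ⦄, IsSmoothProjective 4 X → HasChowZeroSupportedInDimLE X 3 →
    ∀ c : complexBetti X 4, IsRationalClass c → IsOfHodgeType 4 X 4 2 2 c →
      c ∈ supportedClasses X 4 1

/-- STUB (crux, positive-genus side): Voisin's ℚ̄-ENVELOPE for rational (2,2)-classes on smooth
projective fourfolds CARRYING a non-zero (4,0)-class (level ≥ 3: the Hodge locus of `c` in any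
ℚ̄-family is atypical, Baldi–Klingler–Ullmo 2024 Thm 2.3; positive period dimension ⇒ finitely many
maximal atypical special subvarieties, ibid. Thm 2.6, defined over ℚ̄ when weakly non-factor,
Klingler–Otwinowska–Urbanik 2023 Thm 1.12; zero period dimension = rigid special points, OPEN). -/
def PositiveGenusEnvelope : Prop :=
  ∀ ⦃X : SchemeOver ℂ⦄, IsSmoothProjective 4 X → ¬ GenusZero X →
    ∀ c : complexBetti X 4, IsRationalClass c → IsOfHodgeType 4 X 4 2 2 c →
      ∃ (m : ℕ) (W : SchemeOver ℂ) (ι : X ⟶ W) (c' : complexBetti W 4),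
        IsSmoothProjective m W ∧ DefinedOverNumberField W ∧ IsRationalClass c' ∧
          IsOfHodgeType m W 4 2 2 c' ∧ complexBetti.map ι 4 c' = c

/-- STUB (crux, arithmetic side): the Hodge conjecture in CODIMENSION 2 for smooth projective complex
varieties definable over a number field (all dimensions `m`; the route's own PencilReduction /
HardLefschetzReduction, applied to ℚ̄-hyperplane sections, bring it down to `m = 4` over ℚ̄). -/
def QbarCodimTwo : Prop :=
  ∀ ⦃m : ℕ⦄ ⦃W : SchemeOver ℂ⦄, IsSmoothProjective m W → DefinedOverNumberField W →
    ∀ c' : complexBetti W 4, IsRationalClass c' → IsOfHodgeType m W 4 2 2 c' →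
      c' ∈ algebraicClasses W 2

/-- The genus-zero SUPPORT stub is the tree's named Literature fact (Bloch–Srinivas 1983 /
Conte–Murre 1978, Voisin II Prop. 10.26: `CH₀` supported in dimension ≤ 3 ⇒ rational (2,2)-classes
ALGEBRAIC), weakened to divisor support (`N² ⊆ N¹`). In a skeleton it rides as a fact hypothesis. -/
theorem blochSrinivasFour_of_fact
    (h : BlochSrinivas1983_hodgeConjectureDegreeFour_of_chowZeroSupported) : BlochSrinivasFour :=
  fun X hX hW c hc hh => supportedClasses_mono X 4 (show 1 ≤ 2 by norm_num) (h hX hW c hc hh)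

/-- COMPOSITION (kernel-checked): the four stubs and QbarEnvelope's support item
`PullbackAlgebraic` (stmt-1071: pull-back preserves algebraic classes) imply the crux BY NAME. -/
theorem crux_of (hB : BlochFour) (hBS : BlochSrinivasFour) (hE : PositiveGenusEnvelope)
    (hQ : QbarCodimTwo) (hP : Theses.QbarEnvelope.PullbackAlgebraic) : Crux := by
  intro X hX c hc hh
  by_cases hg : GenusZero X
  · -- genus zero: generalized Bloch ⇒ CH₀ on a threefold ⇒ Bloch–Srinivas
    exact hBS hX (hB hX hg) c hc hh
  · -- positive genus: ℚ̄-envelope, HC(·,2) over ℚ̄, pull back, N² ⊆ N¹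
    obtain ⟨m, W, ι, c', hW, hWK, hc', hh', rfl⟩ := hE hX hg c hc hh
    have halgW : c' ∈ algebraicClasses W 2 := hQ hW hWK c' hc' hh'
    have halgX : complexBetti.map ι (2 * 2) c' ∈ algebraicClasses X 2 := hP hX hW ι 2 c' halgW
    exact supportedClasses_mono X 4 (show 1 ≤ 2 by norm_num) halgX

end GenusSwitch

namespace ThetaASD

/-- STUB / FIRST LEMMA of card `theta-asd-off-canonical-divisor`: POSITIVE GENUS REDUCTION — it
suffices to prove the crux for smooth projective fourfolds carrying a non-zero holomorphic 4-form.
Proof to come: for `X` arbitrary take a cyclic cover `π : X' → X` of degree `m` branched along a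
smooth member of `|mL|`, `L` very ample, `m ≫ 0`; then `h^{4,0}(X') > 0`, `π^* c` is a rational
(2,2)-class, and `π^*c` supported on `D'` ⇒ `c` supported on `π(D')` (`π_* π^* = m` on
`H⁴(X ∖ π(D'); ℚ)` for the finite surjective map `π⁻¹(X ∖ π(D')) → X ∖ π(D')`). -/
def PositiveGenusReduction : Prop :=
  (∀ ⦃X : SchemeOver ℂ⦄, IsSmoothProjective 4 X → ¬ GenusZero X →
      ∀ c : complexBetti X 4, IsRationalClass c → IsOfHodgeType 4 X 4 2 2 c →
        c ∈ supportedClasses X 4 1) → Crux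

/-- The positive-genus sector statement, named (the card's transfer target lives inside it). -/
def CruxPositiveGenus : Prop :=
  ∀ ⦃X : SchemeOver ℂ⦄, IsSmoothProjective 4 X → ¬ GenusZero X →
    ∀ c : complexBetti X 4, IsRationalClass c → IsOfHodgeType 4 X 4 2 2 c →
      c ∈ supportedClasses X 4 1

/-- Trivial bookkeeping: the reduction plus the positive-genus sector give the crux. -/
theorem crux_of (hR : PositiveGenusReduction) (hP : CruxPositiveGenus) : Crux := hR hP

/-- And the genus-zero sector is exactly what `GenusSwitch` handles: the two cards share it. -/
theorem crux_of' (hB : GenusSwitch.BlochFour) (hBS : GenusSwitch.BlochSrinivasFour)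
    (hP : CruxPositiveGenus) : Crux := by
  intro X hX c hc hh
  by_cases hg : GenusZero X
  · exact hBS hX (hB hX hg) c hc hh
  · exact hP hX hg c hc hh

end ThetaASD

/-- SERVICE: HolomorphicDefect's support item `FourfoldHodgeClassesConiveauOne` (stmt-3031, the
`n = 4` instance of its thesis `HodgeClassesConiveauOne`) is THIS crux, definitionally. -/
theorem holomorphicDefect_fourfold_iff :
    Theses.HolomorphicDefect.FourfoldHodgeClassesConiveauOne ↔ Crux := Iff.rfl

/-- Hence HolomorphicDefect's global thesis (∀ n p) specialises to the crux. -/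
theorem crux_of_hodgeClassesConiveauOne (h : Theses.HolomorphicDefect.HodgeClassesConiveauOne) :
    Crux := fun X hX c hc hh => h hX 2 c (by norm_num) hc hh

end Summit.HodgeConjecture.HodgeConjecture.Cruxes.MiddleDivisorSupportFourfold

end
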